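/-
Copyright (c) 2026 the pub-hodgecm-mathlib formalisation cell (harness21).  Prover seat hodgecm-mathlib-LH4-p07 (g8), req620 Track A «(D-RAM) FOUR-FRAME» squad
(STAGE-1b pre-scoping, heir LEAD F0P3a-plan (g20∕g21) T19-24 clause; dealer LH4-plan (g12∕g13) WORD #36 «p07 (g8): row-(2) lead»), 2026-09-04.
-/
import Summits.HodgeConjecture.HodgeConjecture.Theorems.F0P3cDyRamBlockCensusOrderFormToken   -- ★ p858981 (this seat): `tokenConeIndex_eq_inter`; brings ★ p858946 (L5-X)∕(L6-X)∕axis token, ★ p858811, ★ (E1), ★ p857501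
import HarnessLib

/-!
# Crux `H413`, line LH4 «(D-RAM) FOUR-FRAME» — STAGE-1b, row (2): organ (C1-P^{X,Y}) part 1 «O-GLUE COUNT WITH TWO BLOCK TOKENS»
# `#{M ∣ SD, Γ·M = M, X·M ⊆ c·M, Y·M ⊆ c′·M} = #{B₂ ∣ SD_W, γ₂B₂ = B₂, X_W·B₂ ⊆ cB₂, Y_W·B₂ ⊆ c′B₂} + Σ_{b=1}^{R} Σᶠ_{B₂ ∈ S_b^{X,c} ∩ T^{Y,c′}} #fibre(ι_W B₂, b)`

Cell `hodgecm-mathlib` (D-0151), FLOOR 0, crux item H413 = `stmt-HodgeConjecture-24833`, route of record `HCCMUnconditional`; squad F0∕P3c∕LH4; lane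
`--supports stmt-HodgeConjecture-24833 --as helper` (count-neutral; pays NO tier-0 row).  THEOREMS ONLY (no `def`, no instance, no notation, no `sorry`).  DATUM-FREE
(`K` valued, `𝒪[K]` a PID, `σ` an isometric involution, `|ϖ| = exp(−1)`, block form with `H₂` hermitian of unit determinant, `|h| = 1`).

WHAT THIS IS.  The third residual STAGE-1b piece of ★ p858649 is the UNLABELLED JOINT PROFILE SET `K_{a,b} = {u ∈ K ∣ X ∈ ϖ^a M₃(𝒪), X² ∈ ϖ^b M₃(𝒪)}` (`X = wMatrix u − 1`);
its `G`-side census at `Γ` counts the self-dual lattices carrying TWO tokens at once — the depth token `(Γ − 1)·M ⊆ ϖ^a·M` and the square token `(Γ − 1)²·M ⊆ ϖ^b·M`.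
★ p858946 (this seat) cut ★ p857501's glue count by ONE generic block-at-1 token `X·M ⊆ c·M`; here the cut is by TWO generic block-at-1 tokens `X·M ⊆ c·M ∧ Y·M ⊆ c′·M`
(`c, c′ ≠ 0`, guards `|X₁₁| ≤ |c|`, `|Y₁₁| ≤ |c′|`).  No new lattice geometry is needed: by ★ p858981 `tokenConeIndex_eq_inter` the one-token cut index set is
`S_b^{X,c} = S_b ∩ T^{X,c}` with the `w₀`-FREE token set `T^{X,c} = {B ∣ c⁻¹X_W·B ⊆ B ∧ ∀ w ∈ B^♯, c⁻¹(X_W w − X₁₁w) ∈ B}`, so the two-token cut index set is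
`S_b^{X,c} ∩ T^{Y,c′}` and (L5)∕(L6) are ★ (L5-X)∕(L6-X) applied to `X` and to `Y`; fibres and ★ T2b's norm-residue weights are UNCHANGED.
* §1 (L5-XY) `comap_planeMatrix_mem_twoTokenConeIndex` ∕ (L6-XY) `mapGL_eq_and_twoToken_of_comap_planeMatrix_mem`: the plane of a two-token fixed self-dual lattice of tube
  coordinate `b ≥ 1` lies in `S_b^{X,c} ∩ T^{Y,c′}`, and conversely membership there gives fixedness and both tokens.
* §2 `finsum_ncard_twoTokenGlueCell_eq_finsum_mem_ncard_glueFibre`: the layer count.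
* §3 HEAD `ncard_fixed_selfDual_endoGL_twoToken_eq_axis_add_sum` (★ p857312's general side condition ⊕ ★ (z1-d) `ncard_selfDual_fixed_axis_eq` with BOTH token labels, read on
  `latt ι(g₂, 1)` by ★ `map_block_latt_endoGL_le_scaleLattice_iff` twice ⊕ §2).
Part 2 (M-letters: cells `levelSetDep(j,b;μ) ∩ levelSetDep(j,b;μ_X) ∩ levelSetDep(j,b;μ_Y)`, and the instance `X = Γ − 1`, `Y = (Γ − 1)²` = the piece `K_{a,b}`) is the sequel.
HONEST LABEL.  Count-neutral lattice bookkeeping; nothing printed is asserted; no census law is stated; `HC_CM` is proved only modulo the 7 printed citations (2 remaining named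
inputs: hLiu418 = `stmt-HodgeConjecture-24832`, h413 = `stmt-HodgeConjecture-24833`) until rung 0 closes.

## References
* [BruhatTits1972] F. Bruhat, J. Tits, *Groupes réductifs sur un corps local I*, Publ. Math. IHÉS 41 (1972), §10.
* [Kottwitz1986BaseChangeUnits] R. E. Kottwitz, *Base change for unit elements of Hecke algebras*, Compositio Math. 60 (1986), §1 pp. 240–241.
* [Jacobowitz1962] R. Jacobowitz, *Hermitian forms over local fields*, Amer. J. Math. 84 (1962), §4.
* [Rogawski1990] J. D. Rogawski, *Automorphic Representations of Unitary Groups in Three Variables*, Ann. of Math. Stud. 123 (1990), §4.8 Case (a) p. 53, §4.9 p. 55.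
-/

set_option autoImplicit false

noncomputable section

namespace Summit.HodgeConjecture.HodgeConjecture.Cruxes.H413.F0P3cDyRamBlockGlueTwoTokenCount

open scoped Valued WithZero Matrix MatrixGroups
open Literature.NumberTheory.Automorphic Literature.NumberTheory.Automorphic.HermitianLattice Literature.NumberTheory.Automorphic.UnitaryLatticeTree
open Literature.NumberTheory.Rogawski1990
open Summit.HodgeConjecture.HodgeConjecture.Cruxes.H413.F0P3cDyRamBlockGluePlane
open Summit.HodgeConjecture.HodgeConjecture.Cruxes.H413.F0P3cDyRamBlockGlueCount
open Summit.HodgeConjecture.HodgeConjecture.Cruxes.H413.F0P3cDyRamBlockGlueLevelCount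
open Summit.HodgeConjecture.HodgeConjecture.Cruxes.H413.F0P3cDyRamBlockGlueTokenCount
open Summit.HodgeConjecture.HodgeConjecture.Cruxes.H413.F0P3cDyRamBlockCensusOrderFormToken

variable {K : Type*} [Field K] [Valued K ℤᵐ⁰]

/-! ## §1 The cut cone index set with two tokens: `S_b^{X,c} ∩ T^{Y,c′}` -/

/-- **(L5-XY)** If `M` is self-dual with tube coordinate `b ≥ 1`, `Γ·M = M` (`Γ = ι(γ₂, u)` unitary, `|u| = 1`), `X·M ⊆ c·M` and `Y·M ⊆ c′·M` (`X`, `Y` block at `1`,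
`c, c′ ≠ 0`, guard `|Y₁₁| ≤ |c′|`), then `ι_W⁻¹(M ∩ W) ∈ S_b^{X,c} ∩ T^{Y,c′}` — ★ (L5-X) for `X`, and ★ (L5-X) for `Y` read through ★ `tokenConeIndex_eq_inter`.
[cite: Kottwitz1986BaseChangeUnits, §1 pp. 240–241] [cite: BruhatTits1972, §10] [cite: Jacobowitz1962, §4] -/
theorem comap_planeMatrix_mem_twoTokenConeIndex [IsPrincipalIdealRing 𝒪[K]] (σ : K →+* K) (hσ : ∀ a, σ (σ a) = a)
    (hvσ : ∀ a, Valued.v (σ a) = Valued.v a) {ϖ : K} (hϖ : Valued.v ϖ = WithZero.exp (-1 : ℤ))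
    {H₂ : Matrix (Fin 2) (Fin 2) K} (hH₂ : IsUnit H₂.det) (hH₂σ : (H₂.map σ)ᵀ = H₂) {h : K} (hh : Valued.v h = 1)
    {M : Submodule 𝒪[K] (Fin 3 → K)} (hM : IsSelfDualLattice σ ϖ (!![H₂ 0 0, 0, H₂ 0 1; 0, h, 0; H₂ 1 0, 0, H₂ 1 1] : Matrix (Fin 3) (Fin 3) K) M)
    {b : ℕ} (hb1 : 1 ≤ b) (hb : ∀ a : K, (Pi.single 1 a : Fin 3 → K) ∈ M ↔ Valued.v a ≤ Valued.v ϖ ^ b)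
    (γ₂ : GL (Fin 2) K) (u : GL (Fin 1) K) (hΓ : endoGL (γ₂, u) ∈ unitaryGroupOfForm σ (!![H₂ 0 0, 0, H₂ 0 1; 0, h, 0; H₂ 1 0, 0, H₂ 1 1] : Matrix (Fin 3) (Fin 3) K))
    (hu : Valued.v ((u : Matrix (Fin 1) (Fin 1) K) 0 0) = 1) {X : Matrix (Fin 3) (Fin 3) K} (hcol : ∀ l, l ≠ 1 → X l 1 = 0) (hrow : ∀ l, l ≠ 1 → X 1 l = 0)
    {Y : Matrix (Fin 3) (Fin 3) K} (hcolY : ∀ l, l ≠ 1 → Y l 1 = 0) (hrowY : ∀ l, l ≠ 1 → Y 1 l = 0)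
    {c c' : K} (hc : c ≠ 0) (hc' : c' ≠ 0) (hYc : Valued.v (Y 1 1) ≤ Valued.v c')
    (hfix : mapGL (endoGL (γ₂, u)) M = M) (htokX : ∀ x ∈ M, X *ᵥ x ∈ scaleLattice c M) (htokY : ∀ x ∈ M, Y *ᵥ x ∈ scaleLattice c' M) :
    (M ⊓ LinearMap.ker ((LinearMap.proj (1 : Fin 3) : (Fin 3 → K) →ₗ[K] K).restrictScalars 𝒪[K])).comap
        ((Matrix.toLin' (!![1, 0; 0, 0; 0, 1] : Matrix (Fin 3) (Fin 2) K)).restrictScalars 𝒪[K]) ∈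
      {B : Submodule 𝒪[K] (Fin 2 → K) | (∃ g : GL (Fin 2) K, B = latt (g : Matrix (Fin 2) (Fin 2) K)) ∧ mapGL γ₂ B = B ∧
          (∀ y ∈ B, c⁻¹ • ((!![X 0 0, X 0 2; X 2 0, X 2 2] : Matrix (Fin 2) (Fin 2) K) *ᵥ y) ∈ B) ∧
          ∃ w₀ : Fin 2 → K, (∀ w, w ∈ B ↔ (w ∈ dualLatt σ H₂ B ∧ Valued.v (pairing σ H₂ w₀ w) ≤ 1)) ∧
            (∀ w ∈ dualLatt σ H₂ B, ∃ (t : K) (a : Fin 2 → K), Valued.v t ≤ 1 ∧ a ∈ B ∧ w = t • w₀ + a) ∧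
            Valued.v (pairing σ H₂ w₀ w₀) * Valued.v ϖ ^ (2 * b) = 1 ∧
            (γ₂ : Matrix (Fin 2) (Fin 2) K).mulVec w₀ - (u : Matrix (Fin 1) (Fin 1) K) 0 0 • w₀ ∈ B ∧
            c⁻¹ • ((!![X 0 0, X 0 2; X 2 0, X 2 2] : Matrix (Fin 2) (Fin 2) K) *ᵥ w₀ - X 1 1 • w₀) ∈ B} ∩
      {B : Submodule 𝒪[K] (Fin 2 → K) | (∀ y ∈ B, c'⁻¹ • ((!![Y 0 0, Y 0 2; Y 2 0, Y 2 2] : Matrix (Fin 2) (Fin 2) K) *ᵥ y) ∈ B) ∧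
          ∀ w ∈ dualLatt σ H₂ B, c'⁻¹ • ((!![Y 0 0, Y 0 2; Y 2 0, Y 2 2] : Matrix (Fin 2) (Fin 2) K) *ᵥ w - Y 1 1 • w) ∈ B} := by
  refine ⟨comap_planeMatrix_mem_tokenConeIndex σ hσ hvσ hϖ hH₂ hH₂σ hh hM hb1 hb γ₂ u hΓ hu hcol hrow hc hfix htokX, ?_⟩
  have hY := comap_planeMatrix_mem_tokenConeIndex σ hσ hvσ hϖ hH₂ hH₂σ hh hM hb1 hb γ₂ u hΓ hu hcolY hrowY hc' hfix htokY
  rw [tokenConeIndex_eq_inter σ hσ hvσ ϖ hH₂σ γ₂ ((u : Matrix (Fin 1) (Fin 1) K) 0 0)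
    (!![Y 0 0, Y 0 2; Y 2 0, Y 2 2] : Matrix (Fin 2) (Fin 2) K) hc' hYc b] at hY
  exact hY.2

/-- **(L6-XY)** If `M` is self-dual with tube coordinate `b ≥ 1` and `ι_W⁻¹(M ∩ W) ∈ S_b^{X,c} ∩ T^{Y,c′}` (guards `|X₁₁| ≤ |c|`, `|Y₁₁| ≤ |c′|`), then `Γ·M = M`,
`X·M ⊆ c·M` and `Y·M ⊆ c′·M` — ★ (L6-X) for `X`; for `Y`, `S_b^{X,c} ⊆ S_b` and `S_b ∩ T^{Y,c′} = S_b^{Y,c′}` (★ `tokenConeIndex_eq_inter` twice), then ★ (L6-X) for `Y`.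
[cite: Kottwitz1986BaseChangeUnits, §1 pp. 240–241] [cite: BruhatTits1972, §10] [cite: Jacobowitz1962, §4] -/
theorem mapGL_eq_and_twoToken_of_comap_planeMatrix_mem [IsPrincipalIdealRing 𝒪[K]] (σ : K →+* K) (hσ : ∀ a, σ (σ a) = a)
    (hvσ : ∀ a, Valued.v (σ a) = Valued.v a) {ϖ : K} (hϖ : Valued.v ϖ = WithZero.exp (-1 : ℤ))
    {H₂ : Matrix (Fin 2) (Fin 2) K} (hH₂ : IsUnit H₂.det) (hH₂σ : (H₂.map σ)ᵀ = H₂) {h : K} (hh : Valued.v h = 1)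
    {M : Submodule 𝒪[K] (Fin 3 → K)} (hM : IsSelfDualLattice σ ϖ (!![H₂ 0 0, 0, H₂ 0 1; 0, h, 0; H₂ 1 0, 0, H₂ 1 1] : Matrix (Fin 3) (Fin 3) K) M)
    {b : ℕ} (hb1 : 1 ≤ b) (hb : ∀ a : K, (Pi.single 1 a : Fin 3 → K) ∈ M ↔ Valued.v a ≤ Valued.v ϖ ^ b)
    (γ₂ : GL (Fin 2) K) (u : GL (Fin 1) K) (hΓ : endoGL (γ₂, u) ∈ unitaryGroupOfForm σ (!![H₂ 0 0, 0, H₂ 0 1; 0, h, 0; H₂ 1 0, 0, H₂ 1 1] : Matrix (Fin 3) (Fin 3) K))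
    (hu : Valued.v ((u : Matrix (Fin 1) (Fin 1) K) 0 0) = 1) {X : Matrix (Fin 3) (Fin 3) K} (hcol : ∀ l, l ≠ 1 → X l 1 = 0) (hrow : ∀ l, l ≠ 1 → X 1 l = 0)
    {Y : Matrix (Fin 3) (Fin 3) K} (hcolY : ∀ l, l ≠ 1 → Y l 1 = 0) (hrowY : ∀ l, l ≠ 1 → Y 1 l = 0)
    {c c' : K} (hc : c ≠ 0) (hc' : c' ≠ 0) (hXc : Valued.v (X 1 1) ≤ Valued.v c) (hYc : Valued.v (Y 1 1) ≤ Valued.v c')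
    (hS : (M ⊓ LinearMap.ker ((LinearMap.proj (1 : Fin 3) : (Fin 3 → K) →ₗ[K] K).restrictScalars 𝒪[K])).comap
        ((Matrix.toLin' (!![1, 0; 0, 0; 0, 1] : Matrix (Fin 3) (Fin 2) K)).restrictScalars 𝒪[K]) ∈
      {B : Submodule 𝒪[K] (Fin 2 → K) | (∃ g : GL (Fin 2) K, B = latt (g : Matrix (Fin 2) (Fin 2) K)) ∧ mapGL γ₂ B = B ∧
          (∀ y ∈ B, c⁻¹ • ((!![X 0 0, X 0 2; X 2 0, X 2 2] : Matrix (Fin 2) (Fin 2) K) *ᵥ y) ∈ B) ∧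
          ∃ w₀ : Fin 2 → K, (∀ w, w ∈ B ↔ (w ∈ dualLatt σ H₂ B ∧ Valued.v (pairing σ H₂ w₀ w) ≤ 1)) ∧
            (∀ w ∈ dualLatt σ H₂ B, ∃ (t : K) (a : Fin 2 → K), Valued.v t ≤ 1 ∧ a ∈ B ∧ w = t • w₀ + a) ∧
            Valued.v (pairing σ H₂ w₀ w₀) * Valued.v ϖ ^ (2 * b) = 1 ∧
            (γ₂ : Matrix (Fin 2) (Fin 2) K).mulVec w₀ - (u : Matrix (Fin 1) (Fin 1) K) 0 0 • w₀ ∈ B ∧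
            c⁻¹ • ((!![X 0 0, X 0 2; X 2 0, X 2 2] : Matrix (Fin 2) (Fin 2) K) *ᵥ w₀ - X 1 1 • w₀) ∈ B} ∩
      {B : Submodule 𝒪[K] (Fin 2 → K) | (∀ y ∈ B, c'⁻¹ • ((!![Y 0 0, Y 0 2; Y 2 0, Y 2 2] : Matrix (Fin 2) (Fin 2) K) *ᵥ y) ∈ B) ∧
          ∀ w ∈ dualLatt σ H₂ B, c'⁻¹ • ((!![Y 0 0, Y 0 2; Y 2 0, Y 2 2] : Matrix (Fin 2) (Fin 2) K) *ᵥ w - Y 1 1 • w) ∈ B}) :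
    mapGL (endoGL (γ₂, u)) M = M ∧ (∀ x ∈ M, X *ᵥ x ∈ scaleLattice c M) ∧ ∀ x ∈ M, Y *ᵥ x ∈ scaleLattice c' M := by
  have hX := mapGL_eq_and_token_of_comap_planeMatrix_mem_tokenConeIndex σ hσ hvσ hϖ hH₂ hH₂σ hh hM hb1 hb γ₂ u hΓ hu hcol hrow hc hXc hS.1
  have hSX := hS.1
  rw [tokenConeIndex_eq_inter σ hσ hvσ ϖ hH₂σ γ₂ ((u : Matrix (Fin 1) (Fin 1) K) 0 0)
    (!![X 0 0, X 0 2; X 2 0, X 2 2] : Matrix (Fin 2) (Fin 2) K) hc hXc b] at hSX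
  have hSY : (M ⊓ LinearMap.ker ((LinearMap.proj (1 : Fin 3) : (Fin 3 → K) →ₗ[K] K).restrictScalars 𝒪[K])).comap
        ((Matrix.toLin' (!![1, 0; 0, 0; 0, 1] : Matrix (Fin 3) (Fin 2) K)).restrictScalars 𝒪[K]) ∈
      {B : Submodule 𝒪[K] (Fin 2 → K) | (∃ g : GL (Fin 2) K, B = latt (g : Matrix (Fin 2) (Fin 2) K)) ∧ mapGL γ₂ B = B ∧
          (∀ y ∈ B, c'⁻¹ • ((!![Y 0 0, Y 0 2; Y 2 0, Y 2 2] : Matrix (Fin 2) (Fin 2) K) *ᵥ y) ∈ B) ∧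
          ∃ w₀ : Fin 2 → K, (∀ w, w ∈ B ↔ (w ∈ dualLatt σ H₂ B ∧ Valued.v (pairing σ H₂ w₀ w) ≤ 1)) ∧
            (∀ w ∈ dualLatt σ H₂ B, ∃ (t : K) (a : Fin 2 → K), Valued.v t ≤ 1 ∧ a ∈ B ∧ w = t • w₀ + a) ∧
            Valued.v (pairing σ H₂ w₀ w₀) * Valued.v ϖ ^ (2 * b) = 1 ∧
            (γ₂ : Matrix (Fin 2) (Fin 2) K).mulVec w₀ - (u : Matrix (Fin 1) (Fin 1) K) 0 0 • w₀ ∈ B ∧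
            c'⁻¹ • ((!![Y 0 0, Y 0 2; Y 2 0, Y 2 2] : Matrix (Fin 2) (Fin 2) K) *ᵥ w₀ - Y 1 1 • w₀) ∈ B} := by
    rw [tokenConeIndex_eq_inter σ hσ hvσ ϖ hH₂σ γ₂ ((u : Matrix (Fin 1) (Fin 1) K) 0 0)
      (!![Y 0 0, Y 0 2; Y 2 0, Y 2 2] : Matrix (Fin 2) (Fin 2) K) hc' hYc b]
    exact ⟨hSX.1, hS.2⟩
  exact ⟨hX.1, hX.2,
    (mapGL_eq_and_token_of_comap_planeMatrix_mem_tokenConeIndex σ hσ hvσ hϖ hH₂ hH₂σ hh hM hb1 hb γ₂ u hΓ hu hcolY hrowY hc' hYc hSY).2⟩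

/-! ## §2 The layer count with two tokens -/

/-- **LAYER COUNT WITH TWO GENERIC TOKENS** (`Γ` unitary with finite fixed family; `X`, `Y` block at `1`; `c, c′ ≠ 0`, guards `|X₁₁| ≤ |c|`, `|Y₁₁| ≤ |c′|`; `b ≥ 1`):
`Σᶠ_B #{M ∣ SD, Γ·M = M, X·M ⊆ c·M, Y·M ⊆ c′·M, tube b, M ∩ W = B} = Σᶠ_{B₂ ∈ S_b^{X,c} ∩ T^{Y,c′}} #{M ∣ SD, M ∩ W = ι_W B₂, tube b}`.
[cite: BruhatTits1972, §10] [cite: Kottwitz1986BaseChangeUnits, §1 pp. 240–241] [cite: Jacobowitz1962, §4] -/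
theorem finsum_ncard_twoTokenGlueCell_eq_finsum_mem_ncard_glueFibre [IsPrincipalIdealRing 𝒪[K]] (σ : K →+* K) (hσ : ∀ a, σ (σ a) = a)
    (hvσ : ∀ a, Valued.v (σ a) = Valued.v a) {ϖ : K} (hϖ : Valued.v ϖ = WithZero.exp (-1 : ℤ))
    {H₂ : Matrix (Fin 2) (Fin 2) K} (hH₂ : IsUnit H₂.det) (hH₂σ : (H₂.map σ)ᵀ = H₂) {h : K} (hh : Valued.v h = 1)
    (γ₂ : GL (Fin 2) K) (u : GL (Fin 1) K) (hΓ : endoGL (γ₂, u) ∈ unitaryGroupOfForm σ (!![H₂ 0 0, 0, H₂ 0 1; 0, h, 0; H₂ 1 0, 0, H₂ 1 1] : Matrix (Fin 3) (Fin 3) K))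
    (hu : Valued.v ((u : Matrix (Fin 1) (Fin 1) K) 0 0) = 1) {X : Matrix (Fin 3) (Fin 3) K} (hcol : ∀ l, l ≠ 1 → X l 1 = 0) (hrow : ∀ l, l ≠ 1 → X 1 l = 0)
    {Y : Matrix (Fin 3) (Fin 3) K} (hcolY : ∀ l, l ≠ 1 → Y l 1 = 0) (hrowY : ∀ l, l ≠ 1 → Y 1 l = 0)
    {c c' : K} (hc : c ≠ 0) (hc' : c' ≠ 0) (hXc : Valued.v (X 1 1) ≤ Valued.v c) (hYc : Valued.v (Y 1 1) ≤ Valued.v c')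
    (hfin : {M : Submodule 𝒪[K] (Fin 3 → K) |
      IsSelfDualLattice σ ϖ (!![H₂ 0 0, 0, H₂ 0 1; 0, h, 0; H₂ 1 0, 0, H₂ 1 1] : Matrix (Fin 3) (Fin 3) K) M ∧ mapGL (endoGL (γ₂, u)) M = M}.Finite)
    {b : ℕ} (hb1 : 1 ≤ b) :
    ∑ᶠ B : Submodule 𝒪[K] (Fin 3 → K),
        {M : Submodule 𝒪[K] (Fin 3 → K) |
          (IsSelfDualLattice σ ϖ (!![H₂ 0 0, 0, H₂ 0 1; 0, h, 0; H₂ 1 0, 0, H₂ 1 1] : Matrix (Fin 3) (Fin 3) K) M ∧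
              (mapGL (endoGL (γ₂, u)) M = M ∧ (∀ x ∈ M, X *ᵥ x ∈ scaleLattice c M) ∧ ∀ x ∈ M, Y *ᵥ x ∈ scaleLattice c' M)) ∧
            (∀ a : K, (Pi.single 1 a : Fin 3 → K) ∈ M ↔ Valued.v a ≤ Valued.v ϖ ^ b) ∧
            M ⊓ LinearMap.ker ((LinearMap.proj (1 : Fin 3) : (Fin 3 → K) →ₗ[K] K).restrictScalars 𝒪[K]) = B}.ncard =
      ∑ᶠ B₂ ∈ {B : Submodule 𝒪[K] (Fin 2 → K) | (∃ g : GL (Fin 2) K, B = latt (g : Matrix (Fin 2) (Fin 2) K)) ∧ mapGL γ₂ B = B ∧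
          (∀ y ∈ B, c⁻¹ • ((!![X 0 0, X 0 2; X 2 0, X 2 2] : Matrix (Fin 2) (Fin 2) K) *ᵥ y) ∈ B) ∧
          ∃ w₀ : Fin 2 → K, (∀ w, w ∈ B ↔ (w ∈ dualLatt σ H₂ B ∧ Valued.v (pairing σ H₂ w₀ w) ≤ 1)) ∧
            (∀ w ∈ dualLatt σ H₂ B, ∃ (t : K) (a : Fin 2 → K), Valued.v t ≤ 1 ∧ a ∈ B ∧ w = t • w₀ + a) ∧
            Valued.v (pairing σ H₂ w₀ w₀) * Valued.v ϖ ^ (2 * b) = 1 ∧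
            (γ₂ : Matrix (Fin 2) (Fin 2) K).mulVec w₀ - (u : Matrix (Fin 1) (Fin 1) K) 0 0 • w₀ ∈ B ∧
            c⁻¹ • ((!![X 0 0, X 0 2; X 2 0, X 2 2] : Matrix (Fin 2) (Fin 2) K) *ᵥ w₀ - X 1 1 • w₀) ∈ B} ∩
        {B : Submodule 𝒪[K] (Fin 2 → K) | (∀ y ∈ B, c'⁻¹ • ((!![Y 0 0, Y 0 2; Y 2 0, Y 2 2] : Matrix (Fin 2) (Fin 2) K) *ᵥ y) ∈ B) ∧
          ∀ w ∈ dualLatt σ H₂ B, c'⁻¹ • ((!![Y 0 0, Y 0 2; Y 2 0, Y 2 2] : Matrix (Fin 2) (Fin 2) K) *ᵥ w - Y 1 1 • w) ∈ B},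
        {M : Submodule 𝒪[K] (Fin 3 → K) | IsSelfDualLattice σ ϖ (!![H₂ 0 0, 0, H₂ 0 1; 0, h, 0; H₂ 1 0, 0, H₂ 1 1] : Matrix (Fin 3) (Fin 3) K) M ∧
            M ⊓ LinearMap.ker ((LinearMap.proj (1 : Fin 3) : (Fin 3 → K) →ₗ[K] K).restrictScalars 𝒪[K]) =
              B₂.map ((Matrix.toLin' (!![1, 0; 0, 0; 0, 1] : Matrix (Fin 3) (Fin 2) K)).restrictScalars 𝒪[K]) ∧
            ∀ a : K, (Pi.single 1 a : Fin 3 → K) ∈ M ↔ Valued.v a ≤ Valued.v ϖ ^ b}.ncard := by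
  classical
  set H : Matrix (Fin 3) (Fin 3) K := !![H₂ 0 0, 0, H₂ 0 1; 0, h, 0; H₂ 1 0, 0, H₂ 1 1] with hHdef
  set Wk : Submodule 𝒪[K] (Fin 3 → K) := LinearMap.ker ((LinearMap.proj (1 : Fin 3) : (Fin 3 → K) →ₗ[K] K).restrictScalars 𝒪[K]) with hWk
  set ι := ((Matrix.toLin' (!![1, 0; 0, 0; 0, 1] : Matrix (Fin 3) (Fin 2) K)).restrictScalars 𝒪[K]) with hι
  set S : Set (Submodule 𝒪[K] (Fin 2 → K)) := {B : Submodule 𝒪[K] (Fin 2 → K) | (∃ g : GL (Fin 2) K, B = latt (g : Matrix (Fin 2) (Fin 2) K)) ∧ mapGL γ₂ B = B ∧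
          (∀ y ∈ B, c⁻¹ • ((!![X 0 0, X 0 2; X 2 0, X 2 2] : Matrix (Fin 2) (Fin 2) K) *ᵥ y) ∈ B) ∧
          ∃ w₀ : Fin 2 → K, (∀ w, w ∈ B ↔ (w ∈ dualLatt σ H₂ B ∧ Valued.v (pairing σ H₂ w₀ w) ≤ 1)) ∧
            (∀ w ∈ dualLatt σ H₂ B, ∃ (t : K) (a : Fin 2 → K), Valued.v t ≤ 1 ∧ a ∈ B ∧ w = t • w₀ + a) ∧
            Valued.v (pairing σ H₂ w₀ w₀) * Valued.v ϖ ^ (2 * b) = 1 ∧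
            (γ₂ : Matrix (Fin 2) (Fin 2) K).mulVec w₀ - (u : Matrix (Fin 1) (Fin 1) K) 0 0 • w₀ ∈ B ∧
            c⁻¹ • ((!![X 0 0, X 0 2; X 2 0, X 2 2] : Matrix (Fin 2) (Fin 2) K) *ᵥ w₀ - X 1 1 • w₀) ∈ B} ∩
        {B : Submodule 𝒪[K] (Fin 2 → K) | (∀ y ∈ B, c'⁻¹ • ((!![Y 0 0, Y 0 2; Y 2 0, Y 2 2] : Matrix (Fin 2) (Fin 2) K) *ᵥ y) ∈ B) ∧
          ∀ w ∈ dualLatt σ H₂ B, c'⁻¹ • ((!![Y 0 0, Y 0 2; Y 2 0, Y 2 2] : Matrix (Fin 2) (Fin 2) K) *ᵥ w - Y 1 1 • w) ∈ B} with hSdef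
  set L : Set (Submodule 𝒪[K] (Fin 3 → K)) := {M | (IsSelfDualLattice σ ϖ H M ∧
      (mapGL (endoGL (γ₂, u)) M = M ∧ (∀ x ∈ M, X *ᵥ x ∈ scaleLattice c M) ∧ ∀ x ∈ M, Y *ᵥ x ∈ scaleLattice c' M)) ∧
      ∀ a : K, (Pi.single 1 a : Fin 3 → K) ∈ M ↔ Valued.v a ≤ Valued.v ϖ ^ b} with hL
  have hLfin : L.Finite := hfin.subset fun M hM => ⟨hM.1.1, hM.1.2.1⟩
  have h1 : (∑ᶠ B : Submodule 𝒪[K] (Fin 3 → K), {M : Submodule 𝒪[K] (Fin 3 → K) | (IsSelfDualLattice σ ϖ H M ∧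
      (mapGL (endoGL (γ₂, u)) M = M ∧ (∀ x ∈ M, X *ᵥ x ∈ scaleLattice c M) ∧ ∀ x ∈ M, Y *ᵥ x ∈ scaleLattice c' M)) ∧
      (∀ a : K, (Pi.single 1 a : Fin 3 → K) ∈ M ↔ Valued.v a ≤ Valued.v ϖ ^ b) ∧ M ⊓ Wk = B}.ncard) = L.ncard := by
    rw [ncard_eq_finsum_ncard_fiber L hLfin fun M => M ⊓ Wk]
    refine finsum_congr fun B => ?_
    congr 1
    ext M
    simp only [hL, Set.mem_setOf_eq, and_assoc]
  rw [h1, ncard_eq_finsum_ncard_fiber L hLfin fun M => (M ⊓ Wk).comap ι, finsum_mem_def]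
  refine finsum_congr fun B₂ => ?_
  by_cases hS : B₂ ∈ S
  · rw [Set.indicator_of_mem hS]
    congr 1
    ext M
    simp only [hL, Set.mem_setOf_eq]
    constructor
    · rintro ⟨⟨⟨hSD, -⟩, htube⟩, hκ⟩
      refine ⟨hSD, ?_, htube⟩
      rw [← hκ, map_comap_planeMatrix_inf_ker]
    · rintro ⟨hSD, hW, htube⟩
      have hκ : (M ⊓ Wk).comap ι = B₂ := by rw [hW, Submodule.comap_map_eq_of_injective planeMatrix_injective]
      have hS' := hS
      rw [← hκ] at hS'
      exact ⟨⟨⟨hSD, mapGL_eq_and_twoToken_of_comap_planeMatrix_mem σ hσ hvσ hϖ hH₂ hH₂σ hh hSD hb1 htube γ₂ u hΓ hu hcol hrow hcolY hrowY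
        hc hc' hXc hYc hS'⟩, htube⟩, hκ⟩
  · rw [Set.indicator_of_notMem hS]
    have hempty : {M : Submodule 𝒪[K] (Fin 3 → K) | M ∈ L ∧ (M ⊓ Wk).comap ι = B₂} = ∅ := by
      ext M
      simp only [hL, Set.mem_setOf_eq, Set.mem_empty_iff_false, iff_false]
      rintro ⟨⟨⟨hSD, hfix, htokX, htokY⟩, htube⟩, hκ⟩
      have hmem := comap_planeMatrix_mem_twoTokenConeIndex σ hσ hvσ hϖ hH₂ hH₂σ hh hSD hb1 htube γ₂ u hΓ hu hcol hrow hcolY hrowY hc hc' hYc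
        hfix htokX htokY
      rw [hκ] at hmem
      exact hS hmem
    rw [hempty, Set.ncard_empty]

/-! ## §3 HEAD — the fixed self-dual lattices WITH TWO GENERIC BLOCK TOKENS, counted through the plane -/

/-- **(C1-P^{X,Y}) PART 1 — O-GLUE COUNT WITH TWO GENERIC BLOCK TOKENS (HEAD).**  Block form `H` (`σ` an isometric involution, `H₂` hermitian with unit determinant, `|h| = 1`,
`𝒪` a PID, `|ϖ| = exp(−1)`); `Γ = ι(γ₂, u)` unitary with `|u| = 1` and finite fixed family whose tube coordinates are `≤ R`; `X`, `Y` block at `1`; `c, c′ ≠ 0`, guards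
`|X₁₁| ≤ |c|`, `|Y₁₁| ≤ |c′|`.  Then
`#{M ∣ SD, Γ·M = M, M.map X ≤ c·M, M.map Y ≤ c′·M} = #{B₂ ∣ SD_W, γ₂B₂ = B₂, B₂.map X_W ≤ c·B₂, B₂.map Y_W ≤ c′·B₂} + Σ_{b ∈ Icc 1 R} Σᶠ_{B₂ ∈ S_b^{X,c} ∩ T^{Y,c′}} #fibre(ι_W B₂, b)`
— ★ p857312 (general side condition) ⊕ ★ (z1-d) with both token labels (★ `map_block_latt_endoGL_le_scaleLattice_iff` twice) ⊕ §2.  The piece `K_{a,b}`: `X = Γ − 1`, `Y = (Γ − 1)²`.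
[cite: Kottwitz1986BaseChangeUnits, §1 pp. 240–241] [cite: BruhatTits1972, §10] [cite: Jacobowitz1962, §4] [cite: Rogawski1990, §4.9 p. 55] -/
theorem ncard_fixed_selfDual_endoGL_twoToken_eq_axis_add_sum [IsPrincipalIdealRing 𝒪[K]] (σ : K →+* K) (hσ : ∀ a, σ (σ a) = a)
    (hvσ : ∀ a, Valued.v (σ a) = Valued.v a) {ϖ : K} (hϖ : Valued.v ϖ = WithZero.exp (-1 : ℤ))
    {H₂ : Matrix (Fin 2) (Fin 2) K} (hH₂ : IsUnit H₂.det) (hH₂σ : (H₂.map σ)ᵀ = H₂) {h : K} (hh : Valued.v h = 1)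
    (γ₂ : GL (Fin 2) K) (u : GL (Fin 1) K) (hΓ : endoGL (γ₂, u) ∈ unitaryGroupOfForm σ (!![H₂ 0 0, 0, H₂ 0 1; 0, h, 0; H₂ 1 0, 0, H₂ 1 1] : Matrix (Fin 3) (Fin 3) K))
    (hu : Valued.v ((u : Matrix (Fin 1) (Fin 1) K) 0 0) = 1) {X : Matrix (Fin 3) (Fin 3) K} (hcol : ∀ l, l ≠ 1 → X l 1 = 0) (hrow : ∀ l, l ≠ 1 → X 1 l = 0)
    {Y : Matrix (Fin 3) (Fin 3) K} (hcolY : ∀ l, l ≠ 1 → Y l 1 = 0) (hrowY : ∀ l, l ≠ 1 → Y 1 l = 0)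
    {c c' : K} (hc : c ≠ 0) (hc' : c' ≠ 0) (hXc : Valued.v (X 1 1) ≤ Valued.v c) (hYc : Valued.v (Y 1 1) ≤ Valued.v c') {R : ℕ}
    (hfin : {M : Submodule 𝒪[K] (Fin 3 → K) |
      IsSelfDualLattice σ ϖ (!![H₂ 0 0, 0, H₂ 0 1; 0, h, 0; H₂ 1 0, 0, H₂ 1 1] : Matrix (Fin 3) (Fin 3) K) M ∧ mapGL (endoGL (γ₂, u)) M = M}.Finite)
    (hR : ∀ M : Submodule 𝒪[K] (Fin 3 → K), IsSelfDualLattice σ ϖ (!![H₂ 0 0, 0, H₂ 0 1; 0, h, 0; H₂ 1 0, 0, H₂ 1 1] : Matrix (Fin 3) (Fin 3) K) M →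
      mapGL (endoGL (γ₂, u)) M = M → ∀ b : ℕ, (∀ a : K, (Pi.single 1 a : Fin 3 → K) ∈ M ↔ Valued.v a ≤ Valued.v ϖ ^ b) → b ≤ R) :
    {M : Submodule 𝒪[K] (Fin 3 → K) |
        IsSelfDualLattice σ ϖ (!![H₂ 0 0, 0, H₂ 0 1; 0, h, 0; H₂ 1 0, 0, H₂ 1 1] : Matrix (Fin 3) (Fin 3) K) M ∧ mapGL (endoGL (γ₂, u)) M = M ∧
          M.map ((Matrix.toLin' X).restrictScalars 𝒪[K]) ≤ scaleLattice c M ∧ M.map ((Matrix.toLin' Y).restrictScalars 𝒪[K]) ≤ scaleLattice c' M}.ncard =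
      {B₂ : Submodule 𝒪[K] (Fin 2 → K) | IsSelfDualLattice σ ϖ H₂ B₂ ∧ mapGL γ₂ B₂ = B₂ ∧
          B₂.map ((Matrix.toLin' (!![X 0 0, X 0 2; X 2 0, X 2 2] : Matrix (Fin 2) (Fin 2) K)).restrictScalars 𝒪[K]) ≤ scaleLattice c B₂ ∧
          B₂.map ((Matrix.toLin' (!![Y 0 0, Y 0 2; Y 2 0, Y 2 2] : Matrix (Fin 2) (Fin 2) K)).restrictScalars 𝒪[K]) ≤ scaleLattice c' B₂}.ncard +
        ∑ b ∈ Finset.Icc 1 R, ∑ᶠ B₂ ∈ {B : Submodule 𝒪[K] (Fin 2 → K) | (∃ g : GL (Fin 2) K, B = latt (g : Matrix (Fin 2) (Fin 2) K)) ∧ mapGL γ₂ B = B ∧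
            (∀ y ∈ B, c⁻¹ • ((!![X 0 0, X 0 2; X 2 0, X 2 2] : Matrix (Fin 2) (Fin 2) K) *ᵥ y) ∈ B) ∧
            ∃ w₀ : Fin 2 → K, (∀ w, w ∈ B ↔ (w ∈ dualLatt σ H₂ B ∧ Valued.v (pairing σ H₂ w₀ w) ≤ 1)) ∧
              (∀ w ∈ dualLatt σ H₂ B, ∃ (t : K) (a : Fin 2 → K), Valued.v t ≤ 1 ∧ a ∈ B ∧ w = t • w₀ + a) ∧
              Valued.v (pairing σ H₂ w₀ w₀) * Valued.v ϖ ^ (2 * b) = 1 ∧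
              (γ₂ : Matrix (Fin 2) (Fin 2) K).mulVec w₀ - (u : Matrix (Fin 1) (Fin 1) K) 0 0 • w₀ ∈ B ∧
              c⁻¹ • ((!![X 0 0, X 0 2; X 2 0, X 2 2] : Matrix (Fin 2) (Fin 2) K) *ᵥ w₀ - X 1 1 • w₀) ∈ B} ∩
          {B : Submodule 𝒪[K] (Fin 2 → K) | (∀ y ∈ B, c'⁻¹ • ((!![Y 0 0, Y 0 2; Y 2 0, Y 2 2] : Matrix (Fin 2) (Fin 2) K) *ᵥ y) ∈ B) ∧
            ∀ w ∈ dualLatt σ H₂ B, c'⁻¹ • ((!![Y 0 0, Y 0 2; Y 2 0, Y 2 2] : Matrix (Fin 2) (Fin 2) K) *ᵥ w - Y 1 1 • w) ∈ B},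
          {M : Submodule 𝒪[K] (Fin 3 → K) | IsSelfDualLattice σ ϖ (!![H₂ 0 0, 0, H₂ 0 1; 0, h, 0; H₂ 1 0, 0, H₂ 1 1] : Matrix (Fin 3) (Fin 3) K) M ∧
              M ⊓ LinearMap.ker ((LinearMap.proj (1 : Fin 3) : (Fin 3 → K) →ₗ[K] K).restrictScalars 𝒪[K]) =
                B₂.map ((Matrix.toLin' (!![1, 0; 0, 0; 0, 1] : Matrix (Fin 3) (Fin 2) K)).restrictScalars 𝒪[K]) ∧
              ∀ a : K, (Pi.single 1 a : Fin 3 → K) ∈ M ↔ Valued.v a ≤ Valued.v ϖ ^ b}.ncard := by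
  classical
  have hϖv0 : Valued.v ϖ ≠ 0 := by rw [hϖ]; exact WithZero.exp_ne_zero
  have hϖ0 : ϖ ≠ 0 := fun h0 => hϖv0 (by rw [h0, map_zero])
  have hϖ1 : Valued.v ϖ ≤ 1 := by rw [hϖ, ← WithZero.exp_zero, WithZero.exp_le_exp]; norm_num
  set P : Submodule 𝒪[K] (Fin 3 → K) → Prop := fun M =>
    mapGL (endoGL (γ₂, u)) M = M ∧ (∀ x ∈ M, X *ᵥ x ∈ scaleLattice c M) ∧ ∀ x ∈ M, Y *ᵥ x ∈ scaleLattice c' M with hP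
  have hLHS : {M : Submodule 𝒪[K] (Fin 3 → K) |
        IsSelfDualLattice σ ϖ (!![H₂ 0 0, 0, H₂ 0 1; 0, h, 0; H₂ 1 0, 0, H₂ 1 1] : Matrix (Fin 3) (Fin 3) K) M ∧ mapGL (endoGL (γ₂, u)) M = M ∧
          M.map ((Matrix.toLin' X).restrictScalars 𝒪[K]) ≤ scaleLattice c M ∧ M.map ((Matrix.toLin' Y).restrictScalars 𝒪[K]) ≤ scaleLattice c' M} =
      {M | IsSelfDualLattice σ ϖ (!![H₂ 0 0, 0, H₂ 0 1; 0, h, 0; H₂ 1 0, 0, H₂ 1 1] : Matrix (Fin 3) (Fin 3) K) M ∧ P M} := by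
    ext M; simp only [Set.mem_setOf_eq, hP, map_toLin'_le_scaleLattice_iff_forall_mulVec_mem]
  have hfinP : {M : Submodule 𝒪[K] (Fin 3 → K) |
      IsSelfDualLattice σ ϖ (!![H₂ 0 0, 0, H₂ 0 1; 0, h, 0; H₂ 1 0, 0, H₂ 1 1] : Matrix (Fin 3) (Fin 3) K) M ∧ P M}.Finite :=
    hfin.subset fun M hM => ⟨hM.1, hM.2.1⟩
  have hRP : ∀ M : Submodule 𝒪[K] (Fin 3 → K), IsSelfDualLattice σ ϖ (!![H₂ 0 0, 0, H₂ 0 1; 0, h, 0; H₂ 1 0, 0, H₂ 1 1] : Matrix (Fin 3) (Fin 3) K) M → P M →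
      ∀ b : ℕ, (∀ a : K, (Pi.single 1 a : Fin 3 → K) ∈ M ↔ Valued.v a ≤ Valued.v ϖ ^ b) → b ≤ R := fun M hM hPM => hR M hM hPM.1
  rw [hLHS, ncard_selfDual_eq_ncard_axis_add_sum_finsum_ncard_glueFibre σ hvσ hϖ hH₂ hh P hfinP hRP]
  congr 1
  · -- the axis: ★ (z1-d) with both token labels (★ p858946 §0 reads each on `latt ι(g₂, 1)`)
    have hax := ncard_selfDual_fixed_axis_eq σ hvσ hϖ0 hϖ1 hH₂ hh γ₂ hu
      (fun M => M.map ((Matrix.toLin' X).restrictScalars 𝒪[K]) ≤ scaleLattice c M ∧ M.map ((Matrix.toLin' Y).restrictScalars 𝒪[K]) ≤ scaleLattice c' M)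
      (fun B => B.map ((Matrix.toLin' (!![X 0 0, X 0 2; X 2 0, X 2 2] : Matrix (Fin 2) (Fin 2) K)).restrictScalars 𝒪[K]) ≤ scaleLattice c B ∧
        B.map ((Matrix.toLin' (!![Y 0 0, Y 0 2; Y 2 0, Y 2 2] : Matrix (Fin 2) (Fin 2) K)).restrictScalars 𝒪[K]) ≤ scaleLattice c' B)
      (fun g₂ => by
        rw [map_block_latt_endoGL_le_scaleLattice_iff hc g₂ hcol hrow, map_block_latt_endoGL_le_scaleLattice_iff hc' g₂ hcolY hrowY]
        exact ⟨fun H => ⟨H.1.1, H.2.1⟩, fun H => ⟨⟨H.1, hXc⟩, ⟨H.2, hYc⟩⟩⟩)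
    rw [← hax]
    congr 1
    ext M
    simp only [Set.mem_setOf_eq, hP, map_toLin'_le_scaleLattice_iff_forall_mulVec_mem]
    tauto
  · refine Finset.sum_congr rfl fun b hb => ?_
    have h := finsum_ncard_twoTokenGlueCell_eq_finsum_mem_ncard_glueFibre σ hσ hvσ hϖ hH₂ hH₂σ hh γ₂ u hΓ hu hcol hrow hcolY hrowY hc hc' hXc hYc hfin
      (Finset.mem_Icc.1 hb).1
    simp only [hP]
    exact h

end Summit.HodgeConjecture.HodgeConjecture.Cruxes.H413.F0P3cDyRamBlockGlueTwoTokenCount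

end
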